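import Summits.ResolutionOfSingularities.ResolutionOfSingularities.Theses.PAlteration
import Literature.AlgebraicGeometry.Resolution.AlterationsResolution
import Literature.AlgebraicGeometry.Resolution.ResolutionOfCurves
import Literature.AlgebraicGeometry.Resolution.ArithmeticalThreefolds
import HarnessLib

/-!
# `Pialt` (crux stmt-ResolutionOfSingularities-0555): reformulations, reductions and known cases

Route `pAlteration`, crux `Pialt` = PIAlt_p for every prime `p`: every integral separated scheme of
finite type over a field of characteristic `p` admits a purely inseparable regular alteration
(Abramovich–Oort 2000, Question 2.13 / Cor. 2.9; Temkin 2013, Conj. 1.3.1 — an OPEN conjecture).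

This helper file (landed `--supports stmt-ResolutionOfSingularities-0555`; it does not close the
item) records, sorry-free, where the crux sits:

* `Pialt` is, prime by prime, literally the characteristic-`p` slice of the Literature-registered
  open conjecture `Literature.AlgebraicGeometry.Resolution.AbramovichOortConjecture.{0}`
  (`pialt_iff_forall_isPurelyInseparableAlteration`, `pialt_of_abramovichOortConjecture`,
  `abramovichOortConjecture_of_pialt_of_hironaka1964`); that the summit statement implies `Pialt`
  is `pialt_of_resolutionOfSingularities` of `Theorems/PAlterationPalterationThesisGlue.lean` (not
  restated here) — so no counterexample to `Pialt` exists below the resolution frontier;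
* (reductions usable by any line — descent of the conclusion along purely inseparable alterations
  and `Pialt` ⇔ `Pialt` on NORMAL varieties — live in the companion file
  `PAlterationPialtReductions.lean`, over `Literature…AlterationsPurelyInseparable`);
* known cases of the conclusion of `Pialt` for a single integral `X/k` (any characteristic):
  `X` regular (identity), `dim X ≤ 1` UNCONDITIONALLY (normalisation of curves, in tree),
  `dim X ≤ 2` under the named fact `CossartJannsenSaito2020`, `dim X ≤ 3` under the named fact
  `CossartPiltant2019` (the refuter's attached `PialtDim3.lean`, re-derived here). Consequently any
  counterexample to `Pialt` is an integral variety of dimension `≥ 4` (`≥ 2` unconditionally).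

Sources: M. Temkin, *Inseparable local uniformization*, J. Algebra 373 (2013) (arXiv:0804.1554v3)
§1 p. 3, Conj. 1.3.1; D. Abramovich, F. Oort, *Alterations and resolution of singularities* (2000),
2.9/2.13; A. J. de Jong, Publ. Math. IHÉS 83 (1996), 2.20 (composition of alterations);
V. Cossart, O. Piltant (2019) Thm. 1.1; Cossart–Jannsen–Saito (2020) Thm. 1.2;
R. Hartshorne, *Algebraic Geometry*, V Rem. 3.8.1 (curves: normalise).
-/

noncomputable section

set_option linter.dupNamespace false -- mandated namespace of this single-conjunct summit

namespace Summit.ResolutionOfSingularities.ResolutionOfSingularities.Theorems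

open CategoryTheory AlgebraicGeometry TopologicalSpace
open Literature.AlgebraicGeometry.Resolution
open Summit.ResolutionOfSingularities.ResolutionOfSingularities.Theses.PAlteration (Pialt)

/-! ## The conclusion of `Pialt` for one scheme versus `IsPurelyInseparableAlteration` -/

/-- From a purely inseparable alteration with regular source (Literature vocabulary) to the
conclusion of `Pialt` for an integral `X` (the item's inline vocabulary): proper, integral regular
source, surjective, finite and universally injective over a DENSE open. [folklore] -/
theorem pialtConclusion_of_exists_isPurelyInseparableAlteration {X : Scheme.{0}} [IsIntegral X]
    (h : ∃ (Y : Scheme.{0}) (φ : Y ⟶ X), IsPurelyInseparableAlteration φ ∧ Scheme.IsRegular Y) :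
    ∃ (X' : Scheme.{0}) (g : X' ⟶ X), IsProper g ∧ IsIntegral X' ∧ Scheme.IsRegular X' ∧
      Function.Surjective g.base ∧ ∃ U : X.Opens, Dense (U : Set X) ∧ IsFinite (g ∣_ U) ∧
        UniversallyInjective (g ∣_ U) := by
  obtain ⟨Y, φ, hφ, hreg⟩ := h
  obtain ⟨U, hU, hfin, hui⟩ := hφ.exists_dense
  exact ⟨Y, φ, hφ.isProper, hφ.isIntegral, hreg, hφ.surjective.1, U, hU, hfin, hui⟩

/-- Conversely, the conclusion of `Pialt` for an integral `X` yields a purely inseparable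
alteration with regular source: surjective gives dominant, and a dense open of the non-empty `X`
is non-empty. [folklore] -/
theorem exists_isPurelyInseparableAlteration_of_pialtConclusion {X : Scheme.{0}} [IsIntegral X]
    (h : ∃ (X' : Scheme.{0}) (g : X' ⟶ X), IsProper g ∧ IsIntegral X' ∧ Scheme.IsRegular X' ∧
      Function.Surjective g.base ∧ ∃ U : X.Opens, Dense (U : Set X) ∧ IsFinite (g ∣_ U) ∧
        UniversallyInjective (g ∣_ U)) :
    ∃ (Y : Scheme.{0}) (φ : Y ⟶ X), IsPurelyInseparableAlteration φ ∧ Scheme.IsRegular Y := by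
  obtain ⟨X', g, hprop, hint, hreg, hsurj, U, hU, hfin, hui⟩ := h
  haveI : Surjective g := ⟨hsurj⟩
  exact ⟨X', g, ⟨hint, hprop, inferInstance, U, hU.nonempty, hfin, hui⟩, hreg⟩

/-- The two vocabularies agree: for integral `X`, the conclusion of `Pialt` at `X` is equivalent to
the existence of a purely inseparable alteration with regular source. [folklore] -/
theorem pialtConclusion_iff_exists_isPurelyInseparableAlteration (X : Scheme.{0}) [IsIntegral X] :
    (∃ (X' : Scheme.{0}) (g : X' ⟶ X), IsProper g ∧ IsIntegral X' ∧ Scheme.IsRegular X' ∧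
      Function.Surjective g.base ∧ ∃ U : X.Opens, Dense (U : Set X) ∧ IsFinite (g ∣_ U) ∧
        UniversallyInjective (g ∣_ U)) ↔
    ∃ (Y : Scheme.{0}) (φ : Y ⟶ X), IsPurelyInseparableAlteration φ ∧ Scheme.IsRegular Y :=
  ⟨exists_isPurelyInseparableAlteration_of_pialtConclusion,
    pialtConclusion_of_exists_isPurelyInseparableAlteration⟩

/-! ## `Pialt` is the characteristic-`p` part of the Abramovich–Oort conjecture -/

/-- `Pialt` unfolded into Literature vocabulary: for every prime `p`, every integral separated
finite-type scheme over a field of characteristic `p` has a purely inseparable alteration with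
regular source — i.e. `Pialt` is exactly the positive-characteristic slice of
`AbramovichOortConjecture.{0}` (Temkin 2013, Conj. 1.3.1). [folklore] -/
theorem pialt_iff_forall_isPurelyInseparableAlteration :
    Pialt ↔ ∀ p : ℕ, p.Prime → ∀ (k : Type) [Field k] [CharP k p] (X : Scheme.{0})
      (f : X ⟶ Spec (.of k)), IsSeparated f → LocallyOfFiniteType f → QuasiCompact f →
        IsIntegral X →
          ∃ (Y : Scheme.{0}) (φ : Y ⟶ X), IsPurelyInseparableAlteration φ ∧ Scheme.IsRegular Y := by
  unfold Pialt
  refine ⟨fun h p hp k _ _ X f hs hl hq hi => ?_, fun h p hp k _ _ X f hs hl hq hi => ?_⟩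
  · haveI := hi
    exact exists_isPurelyInseparableAlteration_of_pialtConclusion (h p hp k X f hs hl hq hi)
  · haveI := hi
    exact pialtConclusion_of_exists_isPurelyInseparableAlteration (h p hp k X f hs hl hq hi)

/-- The Abramovich–Oort conjecture (all fields, universe `0`) implies the crux `Pialt`.
[folklore] -/
theorem pialt_of_abramovichOortConjecture (h : AbramovichOortConjecture.{0}) : Pialt := by
  rw [pialt_iff_forall_isPurelyInseparableAlteration]
  intro p _ k _ _ X f hs hl hq hi
  exact h k X f hs hl hq hi

/-- Conversely `Pialt` together with characteristic zero (Hironaka's theorem, the named fact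
`Hironaka1964`, gives resolutions there, hence purely inseparable regular alterations) is the whole
Abramovich–Oort conjecture in universe `0`: every field has characteristic `0` or a prime.
[folklore] -/
theorem abramovichOortConjecture_of_pialt_of_hironaka1964 (h : Pialt) (h0 : Hironaka1964.{0}) :
    AbramovichOortConjecture.{0} := by
  rw [pialt_iff_forall_isPurelyInseparableAlteration] at h
  intro k _ X f hs hl hq hi
  obtain ⟨p, hchar⟩ := CharP.exists k
  rcases CharP.char_is_prime_or_zero k p with hprime | rfl
  · exact h p hprime k X f hs hl hq hi
  · haveI : CharZero k := CharP.charP_to_charZero k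
    haveI := hs; haveI := hl; haveI := hq; haveI := hi
    exact abramovichOort_of_hironaka1964 h0 k X f

/-! ## Known cases of the conclusion of `Pialt` for a single variety -/

/-- A regular integral `X` satisfies the conclusion of `Pialt` via the identity. [folklore] -/
theorem pialtConclusion_of_isRegular (X : Scheme.{0}) [IsIntegral X] (hreg : Scheme.IsRegular X) :
    ∃ (X' : Scheme.{0}) (g : X' ⟶ X), IsProper g ∧ IsIntegral X' ∧ Scheme.IsRegular X' ∧
      Function.Surjective g.base ∧ ∃ U : X.Opens, Dense (U : Set X) ∧ IsFinite (g ∣_ U) ∧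
        UniversallyInjective (g ∣_ U) :=
  pialtConclusion_of_exists_isPurelyInseparableAlteration
    ⟨X, 𝟙 X, isPurelyInseparableAlteration_id X, hreg⟩

/-- An integral `X` that admits a resolution of singularities satisfies the conclusion of `Pialt`
(the resolution itself is the alteration). [folklore] -/
theorem pialtConclusion_of_hasResolution (X : Scheme.{0}) [IsIntegral X]
    (h : Scheme.HasResolution X) :
    ∃ (X' : Scheme.{0}) (g : X' ⟶ X), IsProper g ∧ IsIntegral X' ∧ Scheme.IsRegular X' ∧
      Function.Surjective g.base ∧ ∃ U : X.Opens, Dense (U : Set X) ∧ IsFinite (g ∣_ U) ∧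
        UniversallyInjective (g ∣_ U) :=
  pialtConclusion_of_exists_isPurelyInseparableAlteration
    h.exists_isPurelyInseparableAlteration_and_isRegular

/-- **Curves, unconditionally**: an integral scheme of finite type over a field (any
characteristic; separatedness not needed) of dimension `≤ 1` satisfies the conclusion of `Pialt` —
its normalisation is a finite birational morphism from a regular scheme (in tree:
`hasResolution_of_dim_le_one`, from `NoetherFiniteIntegralClosure_holds`).
[cite: Hartshorne1977, Ch. V Rem. 3.8.1] -/
theorem pialtConclusion_of_dim_le_one (k : Type) [Field k] (X : Scheme.{0})
    (f : X ⟶ Spec (.of k)) [LocallyOfFiniteType f] [QuasiCompact f] [IsIntegral X]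
    (hdim : topologicalKrullDim X ≤ 1) :
    ∃ (X' : Scheme.{0}) (g : X' ⟶ X), IsProper g ∧ IsIntegral X' ∧ Scheme.IsRegular X' ∧
      Function.Surjective g.base ∧ ∃ U : X.Opens, Dense (U : Set X) ∧ IsFinite (g ∣_ U) ∧
        UniversallyInjective (g ∣_ U) :=
  pialtConclusion_of_hasResolution X (hasResolution_of_dim_le_one X f hdim)

/-- **Surfaces, under `CossartJannsenSaito2020`** (resolution of excellent surfaces, named fact):
an integral separated scheme of finite type of dimension `≤ 2` over a field satisfies the
conclusion of `Pialt`. [cite: CossartJannsenSaito2020, Thm. 1.2] -/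
theorem pialtConclusion_of_dim_le_two (hCJS : CossartJannsenSaito2020.{0}) (k : Type) [Field k]
    (X : Scheme.{0}) (f : X ⟶ Spec (.of k)) [IsSeparated f] [LocallyOfFiniteType f]
    [QuasiCompact f] [IsIntegral X] (hdim : topologicalKrullDim X ≤ 2) :
    ∃ (X' : Scheme.{0}) (g : X' ⟶ X), IsProper g ∧ IsIntegral X' ∧ Scheme.IsRegular X' ∧
      Function.Surjective g.base ∧ ∃ U : X.Opens, Dense (U : Set X) ∧ IsFinite (g ∣_ U) ∧
        UniversallyInjective (g ∣_ U) :=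
  pialtConclusion_of_hasResolution X
    (hCJS k X f ‹_› ‹_› ‹_› inferInstance (by exact_mod_cast hdim))

/-- **Threefolds, under `CossartPiltant2019`** (named fact): an integral separated scheme of finite
type of dimension `≤ 3` over a field satisfies the conclusion of `Pialt` (in tree:
`abramovichOort_of_cossartPiltant2019`; this is the refuter's attached `PialtDim3.lean`).
Hence every counterexample to `Pialt` has dimension `≥ 4`. [cite: CossartPiltant2019, Thm. 1.1] -/
theorem pialtConclusion_of_dim_le_three (hCP : CossartPiltant2019.{0}) (k : Type) [Field k]
    (X : Scheme.{0}) (f : X ⟶ Spec (.of k)) [IsSeparated f] [LocallyOfFiniteType f]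
    [QuasiCompact f] [IsIntegral X] (hdim : topologicalKrullDim X ≤ 3) :
    ∃ (X' : Scheme.{0}) (g : X' ⟶ X), IsProper g ∧ IsIntegral X' ∧ Scheme.IsRegular X' ∧
      Function.Surjective g.base ∧ ∃ U : X.Opens, Dense (U : Set X) ∧ IsFinite (g ∣_ U) ∧
        UniversallyInjective (g ∣_ U) :=
  pialtConclusion_of_exists_isPurelyInseparableAlteration
    (abramovichOort_of_cossartPiltant2019 hCP k X f hdim)

/-- `Pialt` restricted to dimension `≤ 1`, in the item's own binder shape, unconditionally.
[cite: Hartshorne1977, Ch. V Rem. 3.8.1] -/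
theorem pialt_dim_le_one :
    ∀ p : ℕ, p.Prime → ∀ (k : Type) [Field k] [CharP k p] (X : Scheme.{0})
      (f : X ⟶ Spec (.of k)), IsSeparated f → LocallyOfFiniteType f → QuasiCompact f →
        IsIntegral X → topologicalKrullDim X ≤ 1 →
          ∃ (X' : Scheme.{0}) (g : X' ⟶ X), IsProper g ∧ IsIntegral X' ∧ Scheme.IsRegular X' ∧
            Function.Surjective g.base ∧ ∃ U : X.Opens, Dense (U : Set X) ∧ IsFinite (g ∣_ U) ∧
              UniversallyInjective (g ∣_ U) := by
  intro p _ k _ _ X f _ hl hq hi hdim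
  haveI := hl; haveI := hq; haveI := hi
  exact pialtConclusion_of_dim_le_one k X f hdim

/-- `Pialt` restricted to dimension `≤ 3`, in the item's own binder shape, under the named fact
`CossartPiltant2019`. [cite: CossartPiltant2019, Thm. 1.1] -/
theorem pialt_dim_le_three (hCP : CossartPiltant2019.{0}) :
    ∀ p : ℕ, p.Prime → ∀ (k : Type) [Field k] [CharP k p] (X : Scheme.{0})
      (f : X ⟶ Spec (.of k)), IsSeparated f → LocallyOfFiniteType f → QuasiCompact f →
        IsIntegral X → topologicalKrullDim X ≤ 3 →
          ∃ (X' : Scheme.{0}) (g : X' ⟶ X), IsProper g ∧ IsIntegral X' ∧ Scheme.IsRegular X' ∧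
            Function.Surjective g.base ∧ ∃ U : X.Opens, Dense (U : Set X) ∧ IsFinite (g ∣_ U) ∧
              UniversallyInjective (g ∣_ U) := by
  intro p _ k _ _ X f hs hl hq hi hdim
  haveI := hs; haveI := hl; haveI := hq; haveI := hi
  exact pialtConclusion_of_dim_le_three hCP k X f hdim

end Summit.ResolutionOfSingularities.ResolutionOfSingularities.Theorems

end
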